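import Literature.MathematicalPhysics.QuantumLattice.DWaveSourceCanonicalClassWindowCertificate
import HarnessLib

/-!
# Sourced window certificates with ENERGY ROWS AT OTHER FIELDS («chord rows»): `Σⱼ κⱼ (Γ E^{src}_{hⱼ} − ℓⱼ·1)`,
# read in the translation-invariant class, the ground-state class and the canonical class

Topic `Literature/MathematicalPhysics/QuantumLattice` (namespace = path); cell `hubbard-cq`, seat `hubbard-cq-obsth-1`
(row «pinning-field K5 menu nodes with the pinning term»). Companion of `DWaveSourceTIClassWindowCertificate` (§9 of the cell's
consumer grammar), `DWaveSourceGSClassWindowCertificate` (§10) and `DWaveSourceCanonicalClassWindowCertificate` (§11).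

A certified sourced energy FLOOR at a field `hⱼ` — «`ℓⱼ ≤ e^{src}_{μ,hⱼ}(σ)` for every translation-invariant `σ` [of the class's
density]» (the cell's E/G/S legs, job-D floors, `#473`-type anchors transported in `h`; state-free form `ℓⱼ ≤ E(hⱼ) =
dWaveSourceEnergyDensityTT' t' U μ hⱼ`) — is a LINEAR ROW valid in every state of the class, at ANY field `hⱼ`, not only at the
field `h` of the program: the dual identity may carry `− Σ_{j∈J} κⱼ • (Γ E^{src}_{μ,hⱼ} − ℓⱼ•1)` on its left-hand side
(`E^{src}_{μ,hⱼ} = (hubbardTTPrimeSourcedInteraction 1 t' U μ dWaveFormFactor hⱼ).meanEnergyObs 1` embedded from `thicken {0} 1`).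
Since `E^{src}_{h₁} − E^{src}_{h} = (h − h₁)(P₀^d + P₀^d†)`-type identities hold at the level of operators, such rows together
with the cap row at `h` reproduce the cell's Griffiths CHORDS inside the SDP («chord ⊕ KKT»: ground-state rows can then only lift
the chord floor of record); with a floor row at the SAME field `h` they are the «KKT + energy window» legs (K1a+E). This file adds
the block to the three readers by moving it into the objective (its expectation is `≥ 0` in every state of the class, and the
class is stable under the 32 flip-twisted transforms):

* §1 `re_expect_fieldRows` (the block's expectation), `fieldRows_premise_of_dWaveSourceEnergyDensityTT'_ge` (state-free discharge:
  `κⱼ ≥ 0`, `ℓⱼ ≤ E(hⱼ)` ⇒ the class premise on ALL translation-invariant states).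
* §2 `IsTranslationInvariant.re_sum_twistedFlipAct_expect_ge_of_sourced_certificate_fieldRows` (every TI state; no ground-state rows),
  §3 `IsMeanEnergyMinimiser.…_kkt_fieldRows` (ground-state class at `μ`), §4 `IsTranslationInvariant.…_kkt_canonical_fieldRows`
  (canonical class, number-conserving ground-state rows, `μ = 0`): the orbit forms with the extra premise
  `∀ σ TI, ρ(σ) = ρ(ω) → ∀ j ∈ J, κⱼ ℓⱼ ≤ κⱼ e^{src}_{hⱼ}(σ)`.
* §5 node shapes for the K1a+E / chord⊕KKT use: pair MIN on the ground-state class and STATE-FREE `c − Σ‖aₖ‖ ≤ −∂⁻E(h)`.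

HONEST FRAMING (cell hubbard-cq): soundness theorems; no certificate, no number, no order parameter, no phase word (finite-`h`
responses, W1). CAP rows are licensed ONLY at the program's own field on the ground-state classes (`e^{src}_h(ω) = E(h)`); at other
fields only FLOOR rows are. Everything is PROVED; no definition, no named fact, no `sorry`. Tree search: `lean search 'fieldRows'` —
nothing; REUSED the three readers, `dWaveSourceEnergyDensityTT'_le_re_expect`, `re_expect_dWaveSourceEnergyObsTT'_eq_meanEnergy`,
`exists_isMeanEnergyMinimiser_two_mul_re_expect_localPairAt_eq_neg_leftDeriv`.

References: R. B. Griffiths, Phys. Rev. 152 (1966) 240, §II [cite: Griffiths1966, §II]; J. Wang et al., PRX 14 (2024) 031006, §III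
[cite: WangEtAl2024, §III]; T. Koma, H. Tasaki, J. Stat. Phys. 76 (1994) 745, §1 [cite: KomaTasaki1994, §1]; O. Bratteli, A. Kishimoto,
D. W. Robinson, CMP 64 (1978) 41, Thm. 2 [cite: BratteliKishimotoRobinson1978, Thm. 2]; M. Araújo et al., arXiv:2311.18707 §3.2 Prop. 11
[cite: AraujoEtAl2023, §3.2 Prop. 11].
-/

noncomputable section

namespace Literature.MathematicalPhysics.QuantumLattice

open Matrix Finset Complex HubbardWave0 Literature.Probability.LatticeModels Set
open Literature.MathematicalPhysics.QuantumManyBody.StateRelaxation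
open scoped ComplexOrder BigOperators

namespace InfVolFermionState

variable {ω : InfVolFermionState 2} {t' U μ h : ℝ}

/-! ## §1 The field-row block and its premise -/

/-- **Expectation of the field-row block**: `Re ω(Σⱼ κⱼ (Γ E^{src}_{hⱼ} − ℓⱼ·1)) = Σⱼ κⱼ (e^{src}_{hⱼ}(ω) − ℓⱼ)`.
[cite: WangEtAl2024, §III] -/
theorem re_expect_fieldRows (ω' : InfVolFermionState 2) (t' U μ : ℝ) {Λ' : Finset (Site 2)}
    (h0 : thicken ({0} : Finset (Site 2)) 1 ⊆ Λ') {J : Type*} (Jf : Finset J) (κf hf lf : J → ℝ) :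
    (ω'.expect Λ' (∑ j ∈ Jf, ((κf j : ℝ) : ℂ) •
        (fermionEmbed (PolySite.incl h0) ((hubbardTTPrimeSourcedInteraction 1 t' U μ dWaveFormFactor (hf j)).meanEnergyObs 1) -
          ((lf j : ℝ) : ℂ) • (1 : FermionOp Λ')))).re =
      ∑ j ∈ Jf, κf j * (ω'.meanEnergy (hubbardTTPrimeSourcedInteraction 1 t' U μ dWaveFormFactor (hf j)) 1 - lf j) := by
  simp only [map_sum, map_smul, map_sub, smul_eq_mul, Complex.re_sum, Complex.re_ofReal_mul, Complex.sub_re, ω'.expect_one,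
    mul_one, Complex.ofReal_re, ω'.compatible h0, InfVolFermionState.meanEnergy]

/-- **The field-row premise in a class**: if `κⱼ ℓⱼ ≤ κⱼ e^{src}_{hⱼ}(σ)` for every `j`, the block has nonnegative expectation in `σ`.
[cite: WangEtAl2024, §III] -/
theorem re_expect_fieldRows_nonneg (ω' : InfVolFermionState 2) (t' U μ : ℝ) {Λ' : Finset (Site 2)}
    (h0 : thicken ({0} : Finset (Site 2)) 1 ⊆ Λ') {J : Type*} (Jf : Finset J) (κf hf lf : J → ℝ)
    (hrows : ∀ j ∈ Jf, κf j * lf j ≤ κf j * ω'.meanEnergy (hubbardTTPrimeSourcedInteraction 1 t' U μ dWaveFormFactor (hf j)) 1) :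
    0 ≤ (ω'.expect Λ' (∑ j ∈ Jf, ((κf j : ℝ) : ℂ) •
        (fermionEmbed (PolySite.incl h0) ((hubbardTTPrimeSourcedInteraction 1 t' U μ dWaveFormFactor (hf j)).meanEnergyObs 1) -
          ((lf j : ℝ) : ℂ) • (1 : FermionOp Λ')))).re := by
  rw [re_expect_fieldRows]
  exact Finset.sum_nonneg fun j hj => by have := hrows j hj; nlinarith

/-- **STATE-FREE discharge of a field row**: a certified floor `ℓ ≤ E(h') = dWaveSourceEnergyDensityTT' t' U μ h'` (e.g. a sourced
SDP floor at `h'` passed to the limit, or a cell `SourcedEnergyLowerRow`) and `κ ≥ 0` give `κ ℓ ≤ κ e^{src}_{h'}(σ)` for EVERY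
translation-invariant `σ` (the variational principle). [cite: BratteliKishimotoRobinson1978, Thm. 2] -/
theorem mul_le_mul_meanEnergy_sourced_of_dWaveSourceEnergyDensityTT'_ge {κ lo h' : ℝ} (hκ : 0 ≤ κ)
    (hlo : lo ≤ dWaveSourceEnergyDensityTT' t' U μ h') (σ : InfVolFermionState 2) (hσ : σ.IsTranslationInvariant) :
    κ * lo ≤ κ * σ.meanEnergy (hubbardTTPrimeSourcedInteraction 1 t' U μ dWaveFormFactor h') 1 := by
  refine mul_le_mul_of_nonneg_left (hlo.trans ?_) hκ
  rw [← re_expect_dWaveSourceEnergyObsTT'_eq_meanEnergy]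
  exact dWaveSourceEnergyDensityTT'_le_re_expect t' U μ h' σ hσ

/-! ## §2 Every translation-invariant state (no ground-state rows) -/

/-- **TI-class reader with field rows**: the identity of `DWaveSourceTIClassWindowCertificate` §2 with the extra block
`− Σ_{j∈J} κⱼ (Γ E^{src}_{μ,hⱼ} − ℓⱼ·1)` on its left-hand side, the rows discharged on the translation-invariant states of density
`ρ(ω)` (`hF`), gives the same conclusion `c − Σ‖aₖ‖ + (Σ_σ μ_σ)(ρ(ω)/2 − ν) ≤ (1/32) Σ_g Re (α_g ω)(Xw)` for every translation-invariant
`ω`. [cite: WangEtAl2024, §III] [cite: Griffiths1966, §II] -/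
theorem IsTranslationInvariant.re_sum_twistedFlipAct_expect_ge_of_sourced_certificate_fieldRows
    (hω : ω.IsTranslationInvariant) (t' U μ h : ℝ) {Λ Λ' : Finset (Site 2)} (hΛ : Λ ⊆ Λ')
    (h0 : thicken ({0} : Finset (Site 2)) 1 ⊆ Λ') (hz : (0 : Site 2) ∈ Λ')
    (Xw : FermionOp Λ') (κp κm u lo : ℝ) (μc : Fin 2 → ℝ) (ν : ℝ)
    (hcap : κp * ω.meanEnergy (hubbardTTPrimeSourcedInteraction 1 t' U μ dWaveFormFactor h) 1 ≤ κp * u)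
    (hlo : ∀ σ : InfVolFermionState 2, σ.IsTranslationInvariant → σ.density = ω.density →
      κm * lo ≤ κm * σ.meanEnergy (hubbardTTPrimeFermionInteraction 1 t' U) 1)
    {J : Type*} (Jf : Finset J) (κf hf lf : J → ℝ)
    (hF : ∀ σ : InfVolFermionState 2, σ.IsTranslationInvariant → σ.density = ω.density →
      ∀ j ∈ Jf, κf j * lf j ≤ κf j * σ.meanEnergy (hubbardTTPrimeSourcedInteraction 1 t' U μ dWaveFormFactor (hf j)) 1)
    {m : Type*} [Fintype m] [DecidableEq m] {Λm : Matrix m m ℂ} (hΛm : Λm.PosSemidef) (O : m → FermionOp Λ')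
    {ι : Type*} (tt : Finset ι) (γ : ι → DihedralGroup 4) (wv : ι → Site 2) (fl mt : ι → Fin 2)
    (hsh : ∀ l, d4ShiftSet (γ l) (wv l) Λ ⊆ Λ') (bb : ι → ℂ) (yw : ι → List (Orb (PolySite Λ) × Bool))
    {δ : Type*} (ah : Finset δ) (dc : δ → ℝ) (V : δ → FermionOp Λ')
    {κ'' : Type*} (w : Finset κ'') (a : κ'' → ℂ) (word : κ'' → List (Orb (PolySite Λ') × Bool)) {c : ℝ}
    (hcert : Xw - (c : ℂ) • (1 : FermionOp Λ') -
        ∑ σ : Fin 2, ((μc σ : ℝ) : ℂ) • (nAt 0 hz σ - ((ν : ℝ) : ℂ) • (1 : FermionOp Λ')) -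
        ((κp : ℝ) : ℂ) • (((u : ℝ) : ℂ) • (1 : FermionOp Λ') -
          fermionEmbed (PolySite.incl h0) ((hubbardTTPrimeSourcedInteraction 1 t' U μ dWaveFormFactor h).meanEnergyObs 1)) -
        ((κm : ℝ) : ℂ) • (fermionEmbed (PolySite.incl h0) ((hubbardTTPrimeFermionInteraction 1 t' U).meanEnergyObs 1) -
          ((lo : ℝ) : ℂ) • (1 : FermionOp Λ')) -
        ∑ j ∈ Jf, ((κf j : ℝ) : ℂ) •
          (fermionEmbed (PolySite.incl h0) ((hubbardTTPrimeSourcedInteraction 1 t' U μ dWaveFormFactor (hf j)).meanEnergyObs 1) -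
            ((lf j : ℝ) : ℂ) • (1 : FermionOp Λ')) =
      gramForm Λm O +
        ∑ l ∈ tt, bb l • (gaugePhase (twistFlipExp (γ l) (fl l) (mt l)) (yw l) •
            fermionEmbed (PolySite.incl (hsh l))
              (fermionEmbed (PolySite.d4Emb (γ l) (wv l) Λ) (spinSwapIter (fl l).val (ladderWord (yw l)))) -
          fermionEmbed (PolySite.incl hΛ) (ladderWord (yw l))) +
        (∑ m' ∈ ah, ((dc m' : ℝ) : ℂ) • ((V m')ᴴ - V m') + ∑ k ∈ w, a k • ladderWord (word k))) :
    c - ∑ k ∈ w, ‖a k‖ + (∑ σ : Fin 2, μc σ) * (ω.density / 2 - ν) ≤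
      (∑ g : TwistFlipIndex, ((ω.twistedFlipAct g).expect Λ' Xw).re) / 32 := by
  set F : FermionOp Λ' := ∑ j ∈ Jf, ((κf j : ℝ) : ℂ) •
    (fermionEmbed (PolySite.incl h0) ((hubbardTTPrimeSourcedInteraction 1 t' U μ dWaveFormFactor (hf j)).meanEnergyObs 1) -
      ((lf j : ℝ) : ℂ) • (1 : FermionOp Λ')) with hFdef
  set N : FermionOp Λ' := ∑ σ : Fin 2, ((μc σ : ℝ) : ℂ) • (nAt 0 hz σ - ((ν : ℝ) : ℂ) • (1 : FermionOp Λ')) with hN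
  set Cp : FermionOp Λ' := ((κp : ℝ) : ℂ) • (((u : ℝ) : ℂ) • (1 : FermionOp Λ') -
    fermionEmbed (PolySite.incl h0) ((hubbardTTPrimeSourcedInteraction 1 t' U μ dWaveFormFactor h).meanEnergyObs 1)) with hCp
  set Cm : FermionOp Λ' := ((κm : ℝ) : ℂ) • (fermionEmbed (PolySite.incl h0)
    ((hubbardTTPrimeFermionInteraction 1 t' U).meanEnergyObs 1) - ((lo : ℝ) : ℂ) • (1 : FermionOp Λ')) with hCm
  have hcert' : (Xw - F) - (c : ℂ) • (1 : FermionOp Λ') - N - Cp - Cm = gramForm Λm O +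
      ∑ l ∈ tt, bb l • (gaugePhase (twistFlipExp (γ l) (fl l) (mt l)) (yw l) •
          fermionEmbed (PolySite.incl (hsh l))
            (fermionEmbed (PolySite.d4Emb (γ l) (wv l) Λ) (spinSwapIter (fl l).val (ladderWord (yw l)))) -
        fermionEmbed (PolySite.incl hΛ) (ladderWord (yw l))) +
      (∑ m' ∈ ah, ((dc m' : ℝ) : ℂ) • ((V m')ᴴ - V m') + ∑ k ∈ w, a k • ladderWord (word k)) := by
    have h1 : (Xw - F) - (c : ℂ) • (1 : FermionOp Λ') - N - Cp - Cm = Xw - (c : ℂ) • (1 : FermionOp Λ') - N - Cp - Cm - F := by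
      abel
    rw [h1, hcert]
  have hmain := hω.re_sum_twistedFlipAct_expect_ge_of_sourced_certificate t' U μ h hΛ h0 hz (Xw - F) κp κm u lo μc ν hcap hlo
    hΛm O tt γ wv fl mt hsh bb yw ah dc V w a word hcert'
  have hg : ∀ g : TwistFlipIndex, ((ω.twistedFlipAct g).expect Λ' (Xw - F)).re ≤ ((ω.twistedFlipAct g).expect Λ' Xw).re := by
    intro g
    have hFg : 0 ≤ ((ω.twistedFlipAct g).expect Λ' F).re :=
      re_expect_fieldRows_nonneg (ω.twistedFlipAct g) t' U μ h0 Jf κf hf lf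
        (hF (ω.twistedFlipAct g) (hω.twistedFlipAct g) (twistedFlipAct_density g ω))
    rw [map_sub, Complex.sub_re]
    linarith
  have hsum := Finset.sum_le_sum fun g (_ : g ∈ (Finset.univ : Finset TwistFlipIndex)) => hg g
  exact hmain.trans (div_le_div_of_nonneg_right hsum (by norm_num))

/-! ## §3 The ground-state class at chemical potential `μ` (all ground-state rows) -/

/-- **GS-class reader with field rows**: the identity of `DWaveSourceGSClassWindowCertificate` §1 (`eom` block, flip-twisted defects,
`kkt` block, arbitrary generators) with the extra field-row block on its left-hand side gives
`c − Σ‖aₖ‖ + (Σ_σ μ_σ)(ρ(ω)/2 − ν) ≤ (1/32) Σ_g Re (α_g ω)(Xw)` for every translation-invariant ground state `ω` of `Φ − μn − hP_d`.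
[cite: WangEtAl2024, §III] [cite: Griffiths1966, §II] [cite: AraujoEtAl2023, §3.2 Prop. 11] -/
theorem IsMeanEnergyMinimiser.re_sum_twistedFlipAct_expect_ge_of_sourced_certificate_kkt_fieldRows
    (hmin : ω.IsMeanEnergyMinimiser (hubbardTTPrimeSourcedInteraction 1 t' U μ dWaveFormFactor h) 1)
    {Λ Λ' : Finset (Site 2)} (hΛ : Λ ⊆ Λ') (h8 : thicken Λ 1 ⊆ Λ') (h0 : thicken ({0} : Finset (Site 2)) 1 ⊆ Λ')
    (hz : (0 : Site 2) ∈ Λ')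
    (Xw : FermionOp Λ') (κp κm u lo : ℝ) (μc : Fin 2 → ℝ) (ν : ℝ)
    (hcap : κp * ω.meanEnergy (hubbardTTPrimeSourcedInteraction 1 t' U μ dWaveFormFactor h) 1 ≤ κp * u)
    (hlo : ∀ σ : InfVolFermionState 2, σ.IsTranslationInvariant → σ.density = ω.density →
      κm * lo ≤ κm * σ.meanEnergy (hubbardTTPrimeFermionInteraction 1 t' U) 1)
    {J : Type*} (Jf : Finset J) (κf hf lf : J → ℝ)
    (hF : ∀ σ : InfVolFermionState 2, σ.IsTranslationInvariant → σ.density = ω.density →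
      ∀ j ∈ Jf, κf j * lf j ≤ κf j * σ.meanEnergy (hubbardTTPrimeSourcedInteraction 1 t' U μ dWaveFormFactor (hf j)) 1)
    {m : Type*} [Fintype m] [DecidableEq m] {Λm : Matrix m m ℂ} (hΛm : Λm.PosSemidef) (O : m → FermionOp Λ')
    {κ' : Type*} (s : Finset κ') (B : κ' → FermionOp Λ)
    {ι : Type*} (tt : Finset ι) (γ : ι → DihedralGroup 4) (wv : ι → Site 2) (fl mt : ι → Fin 2)
    (hsh : ∀ l, d4ShiftSet (γ l) (wv l) Λ ⊆ Λ') (bb : ι → ℂ) (yw : ι → List (Orb (PolySite Λ) × Bool))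
    {δ : Type*} (ah : Finset δ) (dc : δ → ℝ) (V : δ → FermionOp Λ')
    {κ'' : Type*} (w : Finset κ'') (a : κ'' → ℂ) (word : κ'' → List (Orb (PolySite Λ') × Bool))
    {β : Type*} [Fintype β] [DecidableEq β] {G : Matrix β β ℂ} (hG : G.PosSemidef) (Bk : β → FermionOp Λ) {c : ℝ}
    (hcert : Xw - (c : ℂ) • (1 : FermionOp Λ') -
        ∑ σ : Fin 2, ((μc σ : ℝ) : ℂ) • (nAt 0 hz σ - ((ν : ℝ) : ℂ) • (1 : FermionOp Λ')) -
        ((κp : ℝ) : ℂ) • (((u : ℝ) : ℂ) • (1 : FermionOp Λ') -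
          fermionEmbed (PolySite.incl h0) ((hubbardTTPrimeSourcedInteraction 1 t' U μ dWaveFormFactor h).meanEnergyObs 1)) -
        ((κm : ℝ) : ℂ) • (fermionEmbed (PolySite.incl h0) ((hubbardTTPrimeFermionInteraction 1 t' U).meanEnergyObs 1) -
          ((lo : ℝ) : ℂ) • (1 : FermionOp Λ')) -
        ∑ j ∈ Jf, ((κf j : ℝ) : ℂ) •
          (fermionEmbed (PolySite.incl h0) ((hubbardTTPrimeSourcedInteraction 1 t' U μ dWaveFormFactor (hf j)).meanEnergyObs 1) -
            ((lf j : ℝ) : ℂ) • (1 : FermionOp Λ')) =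
      gramForm Λm O +
        (∑ k ∈ s, (pairSourceWindowHamiltonianTT' dWaveFormFactor Λ' t' U μ h * fermionEmbed (PolySite.incl hΛ) (B k) -
            fermionEmbed (PolySite.incl hΛ) (B k) * pairSourceWindowHamiltonianTT' dWaveFormFactor Λ' t' U μ h) +
          ∑ l ∈ tt, bb l • (gaugePhase (twistFlipExp (γ l) (fl l) (mt l)) (yw l) •
              fermionEmbed (PolySite.incl (hsh l))
                (fermionEmbed (PolySite.d4Emb (γ l) (wv l) Λ) (spinSwapIter (fl l).val (ladderWord (yw l)))) -
            fermionEmbed (PolySite.incl hΛ) (ladderWord (yw l)))) +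
        (∑ m' ∈ ah, ((dc m' : ℝ) : ℂ) • ((V m')ᴴ - V m') + ∑ k ∈ w, a k • ladderWord (word k)) +
        kktForm (pairSourceWindowHamiltonianTT' dWaveFormFactor Λ' t' U μ h) G
          (fun b' => fermionEmbed (PolySite.incl hΛ) (Bk b'))) :
    c - ∑ k ∈ w, ‖a k‖ + (∑ σ : Fin 2, μc σ) * (ω.density / 2 - ν) ≤
      (∑ g : TwistFlipIndex, ((ω.twistedFlipAct g).expect Λ' Xw).re) / 32 := by
  set F : FermionOp Λ' := ∑ j ∈ Jf, ((κf j : ℝ) : ℂ) •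
    (fermionEmbed (PolySite.incl h0) ((hubbardTTPrimeSourcedInteraction 1 t' U μ dWaveFormFactor (hf j)).meanEnergyObs 1) -
      ((lf j : ℝ) : ℂ) • (1 : FermionOp Λ')) with hFdef
  set N : FermionOp Λ' := ∑ σ : Fin 2, ((μc σ : ℝ) : ℂ) • (nAt 0 hz σ - ((ν : ℝ) : ℂ) • (1 : FermionOp Λ')) with hN
  set Cp : FermionOp Λ' := ((κp : ℝ) : ℂ) • (((u : ℝ) : ℂ) • (1 : FermionOp Λ') -
    fermionEmbed (PolySite.incl h0) ((hubbardTTPrimeSourcedInteraction 1 t' U μ dWaveFormFactor h).meanEnergyObs 1)) with hCp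
  set Cm : FermionOp Λ' := ((κm : ℝ) : ℂ) • (fermionEmbed (PolySite.incl h0)
    ((hubbardTTPrimeFermionInteraction 1 t' U).meanEnergyObs 1) - ((lo : ℝ) : ℂ) • (1 : FermionOp Λ')) with hCm
  set RHS : FermionOp Λ' := gramForm Λm O +
        (∑ k ∈ s, (pairSourceWindowHamiltonianTT' dWaveFormFactor Λ' t' U μ h * fermionEmbed (PolySite.incl hΛ) (B k) -
            fermionEmbed (PolySite.incl hΛ) (B k) * pairSourceWindowHamiltonianTT' dWaveFormFactor Λ' t' U μ h) +
          ∑ l ∈ tt, bb l • (gaugePhase (twistFlipExp (γ l) (fl l) (mt l)) (yw l) •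
              fermionEmbed (PolySite.incl (hsh l))
                (fermionEmbed (PolySite.d4Emb (γ l) (wv l) Λ) (spinSwapIter (fl l).val (ladderWord (yw l)))) -
            fermionEmbed (PolySite.incl hΛ) (ladderWord (yw l)))) +
        (∑ m' ∈ ah, ((dc m' : ℝ) : ℂ) • ((V m')ᴴ - V m') + ∑ k ∈ w, a k • ladderWord (word k)) +
        kktForm (pairSourceWindowHamiltonianTT' dWaveFormFactor Λ' t' U μ h) G
          (fun b' => fermionEmbed (PolySite.incl hΛ) (Bk b')) with hRHS
  have hcert' : (Xw - F) - (c : ℂ) • (1 : FermionOp Λ') - N - Cp - Cm = RHS := by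
    have h1 : (Xw - F) - (c : ℂ) • (1 : FermionOp Λ') - N - Cp - Cm = Xw - (c : ℂ) • (1 : FermionOp Λ') - N - Cp - Cm - F := by
      abel
    rw [h1, hcert]
  have hmain := hmin.re_sum_twistedFlipAct_expect_ge_of_sourced_certificate_kkt hΛ h8 h0 hz (Xw - F) κp κm u lo μc ν hcap hlo
    hΛm O s B tt γ wv fl mt hsh bb yw ah dc V w a word hG Bk hcert'
  have hg : ∀ g : TwistFlipIndex, ((ω.twistedFlipAct g).expect Λ' (Xw - F)).re ≤ ((ω.twistedFlipAct g).expect Λ' Xw).re := by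
    intro g
    have hFg : 0 ≤ ((ω.twistedFlipAct g).expect Λ' F).re :=
      re_expect_fieldRows_nonneg (ω.twistedFlipAct g) t' U μ h0 Jf κf hf lf
        (hF (ω.twistedFlipAct g) (hmin.1.twistedFlipAct g) (twistedFlipAct_density g ω))
    rw [map_sub, Complex.sub_re]
    linarith
  have hsum := Finset.sum_le_sum fun g (_ : g ∈ (Finset.univ : Finset TwistFlipIndex)) => hg g
  exact hmain.trans (div_le_div_of_nonneg_right hsum (by norm_num))

/-! ## §4 The canonical class (number-conserving ground-state rows, `μ = 0`) -/

/-- **Canonical-class reader with field rows**: the identity of `DWaveSourceCanonicalClassWindowCertificate` §2 (`μ = 0`, number-conserving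
`eom` / `kkt` words) with the extra field-row block `− Σ_{j∈J} κⱼ (Γ E^{src}_{0,hⱼ} − ℓⱼ·1)` (rows discharged on the translation-invariant
states of density `ρ`, e.g. the cell's canonical E-legs at the fields `hⱼ`) gives `c − Σ‖aₖ‖ + (Σ_σ μ_σ)(ρ/2 − ν) ≤ (1/32) Σ_g Re (α_g ω)(Xw)`
for every density-`ρ` minimiser `ω` of `e^{src}_{0,h}`. [cite: WangEtAl2024, §III] [cite: BratteliKishimotoRobinson1978, Thm. 2] -/
theorem IsTranslationInvariant.re_sum_twistedFlipAct_expect_ge_of_sourced_certificate_kkt_canonical_fieldRows {ρ : ℝ}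
    (hω : ω.IsTranslationInvariant) (hρ : ω.density = ρ) (hρ0 : 0 < ρ) (hρ2 : ρ < 2)
    (hmin : ∀ σ : InfVolFermionState 2, σ.IsTranslationInvariant → σ.density = ρ →
      ω.meanEnergy (hubbardTTPrimeSourcedInteraction 1 t' U 0 dWaveFormFactor h) 1 ≤
        σ.meanEnergy (hubbardTTPrimeSourcedInteraction 1 t' U 0 dWaveFormFactor h) 1)
    {Λ Λ' : Finset (Site 2)} (hΛ : Λ ⊆ Λ') (h8 : thicken Λ 1 ⊆ Λ') (h0 : thicken ({0} : Finset (Site 2)) 1 ⊆ Λ')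
    (hz : (0 : Site 2) ∈ Λ')
    (Xw : FermionOp Λ') (κp κm u lo : ℝ) (μc : Fin 2 → ℝ) (ν : ℝ)
    (hcap : κp * ω.meanEnergy (hubbardTTPrimeSourcedInteraction 1 t' U 0 dWaveFormFactor h) 1 ≤ κp * u)
    (hlo : ∀ σ : InfVolFermionState 2, σ.IsTranslationInvariant → σ.density = ω.density →
      κm * lo ≤ κm * σ.meanEnergy (hubbardTTPrimeFermionInteraction 1 t' U) 1)
    {J : Type*} (Jf : Finset J) (κf hf lf : J → ℝ)
    (hF : ∀ σ : InfVolFermionState 2, σ.IsTranslationInvariant → σ.density = ω.density →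
      ∀ j ∈ Jf, κf j * lf j ≤ κf j * σ.meanEnergy (hubbardTTPrimeSourcedInteraction 1 t' U 0 dWaveFormFactor (hf j)) 1)
    {m : Type*} [Fintype m] [DecidableEq m] {Λm : Matrix m m ℂ} (hΛm : Λm.PosSemidef) (O : m → FermionOp Λ')
    {κ' : Type*} (s : Finset κ') (B : κ' → FermionOp Λ) (hB : ∀ k ∈ s, Commute (totalNumber : FermionOp Λ) (B k))
    {ι : Type*} (tt : Finset ι) (γ : ι → DihedralGroup 4) (wv : ι → Site 2) (fl mt : ι → Fin 2)
    (hsh : ∀ l, d4ShiftSet (γ l) (wv l) Λ ⊆ Λ') (bb : ι → ℂ) (yw : ι → List (Orb (PolySite Λ) × Bool))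
    {δ : Type*} (ah : Finset δ) (dc : δ → ℝ) (V : δ → FermionOp Λ')
    {κ'' : Type*} (w : Finset κ'') (a : κ'' → ℂ) (word : κ'' → List (Orb (PolySite Λ') × Bool))
    {β : Type*} [Fintype β] [DecidableEq β] {G : Matrix β β ℂ} (hG : G.PosSemidef) (Bk : β → FermionOp Λ)
    (hBk : ∀ b, Commute (totalNumber : FermionOp Λ) (Bk b)) {c : ℝ}
    (hcert : Xw - (c : ℂ) • (1 : FermionOp Λ') -
        ∑ σ : Fin 2, ((μc σ : ℝ) : ℂ) • (nAt 0 hz σ - ((ν : ℝ) : ℂ) • (1 : FermionOp Λ')) -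
        ((κp : ℝ) : ℂ) • (((u : ℝ) : ℂ) • (1 : FermionOp Λ') -
          fermionEmbed (PolySite.incl h0) ((hubbardTTPrimeSourcedInteraction 1 t' U 0 dWaveFormFactor h).meanEnergyObs 1)) -
        ((κm : ℝ) : ℂ) • (fermionEmbed (PolySite.incl h0) ((hubbardTTPrimeFermionInteraction 1 t' U).meanEnergyObs 1) -
          ((lo : ℝ) : ℂ) • (1 : FermionOp Λ')) -
        ∑ j ∈ Jf, ((κf j : ℝ) : ℂ) •
          (fermionEmbed (PolySite.incl h0) ((hubbardTTPrimeSourcedInteraction 1 t' U 0 dWaveFormFactor (hf j)).meanEnergyObs 1) -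
            ((lf j : ℝ) : ℂ) • (1 : FermionOp Λ')) =
      gramForm Λm O +
        (∑ k ∈ s, (pairSourceWindowHamiltonianTT' dWaveFormFactor Λ' t' U 0 h * fermionEmbed (PolySite.incl hΛ) (B k) -
            fermionEmbed (PolySite.incl hΛ) (B k) * pairSourceWindowHamiltonianTT' dWaveFormFactor Λ' t' U 0 h) +
          ∑ l ∈ tt, bb l • (gaugePhase (twistFlipExp (γ l) (fl l) (mt l)) (yw l) •
              fermionEmbed (PolySite.incl (hsh l))
                (fermionEmbed (PolySite.d4Emb (γ l) (wv l) Λ) (spinSwapIter (fl l).val (ladderWord (yw l)))) -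
            fermionEmbed (PolySite.incl hΛ) (ladderWord (yw l)))) +
        (∑ m' ∈ ah, ((dc m' : ℝ) : ℂ) • ((V m')ᴴ - V m') + ∑ k ∈ w, a k • ladderWord (word k)) +
        kktForm (pairSourceWindowHamiltonianTT' dWaveFormFactor Λ' t' U 0 h) G
          (fun b' => fermionEmbed (PolySite.incl hΛ) (Bk b'))) :
    c - ∑ k ∈ w, ‖a k‖ + (∑ σ : Fin 2, μc σ) * (ω.density / 2 - ν) ≤
      (∑ g : TwistFlipIndex, ((ω.twistedFlipAct g).expect Λ' Xw).re) / 32 := by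
  set F : FermionOp Λ' := ∑ j ∈ Jf, ((κf j : ℝ) : ℂ) •
    (fermionEmbed (PolySite.incl h0) ((hubbardTTPrimeSourcedInteraction 1 t' U 0 dWaveFormFactor (hf j)).meanEnergyObs 1) -
      ((lf j : ℝ) : ℂ) • (1 : FermionOp Λ')) with hFdef
  set N : FermionOp Λ' := ∑ σ : Fin 2, ((μc σ : ℝ) : ℂ) • (nAt 0 hz σ - ((ν : ℝ) : ℂ) • (1 : FermionOp Λ')) with hN
  set Cp : FermionOp Λ' := ((κp : ℝ) : ℂ) • (((u : ℝ) : ℂ) • (1 : FermionOp Λ') -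
    fermionEmbed (PolySite.incl h0) ((hubbardTTPrimeSourcedInteraction 1 t' U 0 dWaveFormFactor h).meanEnergyObs 1)) with hCp
  set Cm : FermionOp Λ' := ((κm : ℝ) : ℂ) • (fermionEmbed (PolySite.incl h0)
    ((hubbardTTPrimeFermionInteraction 1 t' U).meanEnergyObs 1) - ((lo : ℝ) : ℂ) • (1 : FermionOp Λ')) with hCm
  set RHS : FermionOp Λ' := gramForm Λm O +
        (∑ k ∈ s, (pairSourceWindowHamiltonianTT' dWaveFormFactor Λ' t' U 0 h * fermionEmbed (PolySite.incl hΛ) (B k) -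
            fermionEmbed (PolySite.incl hΛ) (B k) * pairSourceWindowHamiltonianTT' dWaveFormFactor Λ' t' U 0 h) +
          ∑ l ∈ tt, bb l • (gaugePhase (twistFlipExp (γ l) (fl l) (mt l)) (yw l) •
              fermionEmbed (PolySite.incl (hsh l))
                (fermionEmbed (PolySite.d4Emb (γ l) (wv l) Λ) (spinSwapIter (fl l).val (ladderWord (yw l)))) -
            fermionEmbed (PolySite.incl hΛ) (ladderWord (yw l)))) +
        (∑ m' ∈ ah, ((dc m' : ℝ) : ℂ) • ((V m')ᴴ - V m') + ∑ k ∈ w, a k • ladderWord (word k)) +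
        kktForm (pairSourceWindowHamiltonianTT' dWaveFormFactor Λ' t' U 0 h) G
          (fun b' => fermionEmbed (PolySite.incl hΛ) (Bk b')) with hRHS
  have hcert' : (Xw - F) - (c : ℂ) • (1 : FermionOp Λ') - N - Cp - Cm = RHS := by
    have h1 : (Xw - F) - (c : ℂ) • (1 : FermionOp Λ') - N - Cp - Cm = Xw - (c : ℂ) • (1 : FermionOp Λ') - N - Cp - Cm - F := by
      abel
    rw [h1, hcert]
  have hmain := hω.re_sum_twistedFlipAct_expect_ge_of_sourced_certificate_kkt_canonical hρ hρ0 hρ2 hmin hΛ h8 h0 hz (Xw - F) κp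
    κm u lo μc ν hcap hlo hΛm O s B hB tt γ wv fl mt hsh bb yw ah dc V w a word hG Bk hBk hcert'
  have hg : ∀ g : TwistFlipIndex, ((ω.twistedFlipAct g).expect Λ' (Xw - F)).re ≤ ((ω.twistedFlipAct g).expect Λ' Xw).re := by
    intro g
    have hFg : 0 ≤ ((ω.twistedFlipAct g).expect Λ' F).re :=
      re_expect_fieldRows_nonneg (ω.twistedFlipAct g) t' U 0 h0 Jf κf hf lf
        (hF (ω.twistedFlipAct g) (hω.twistedFlipAct g) (twistedFlipAct_density g ω))
    rw [map_sub, Complex.sub_re]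
    linarith
  have hsum := Finset.sum_le_sum fun g (_ : g ∈ (Finset.univ : Finset TwistFlipIndex)) => hg g
  exact hmain.trans (div_le_div_of_nonneg_right hsum (by norm_num))

/-! ## §5 Node shapes for «KKT + energy window» / «chord ⊕ KKT» pair-amplitude legs on the ground-state class -/

/-- **PAIR-AMPLITUDE MIN on the ground-state class, with field rows** (`Xw = +(Γ P₀^d + (Γ P₀^d)ᴴ)`; cap row at `h`, floor rows at
the fields `hⱼ`, ground-state rows): `c − Σ‖aₖ‖ + (Σ_σ μ_σ)(ρ(ω)/2 − ν) ≤ 2 Re ω(P₀^d)` for every translation-invariant ground state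
`ω` of `Φ − μn − hP_d`. [cite: KomaTasaki1994, §1] [cite: WangEtAl2024, §III] [cite: Griffiths1966, §II] -/
theorem IsMeanEnergyMinimiser.le_two_mul_re_expect_localPairAt_of_twistedFlip_certificate_kkt_fieldRows
    (hmin : ω.IsMeanEnergyMinimiser (hubbardTTPrimeSourcedInteraction 1 t' U μ dWaveFormFactor h) 1)
    {Λ Λ' : Finset (Site 2)} (hΛ : Λ ⊆ Λ') (h8 : thicken Λ 1 ⊆ Λ') (h0 : thicken ({0} : Finset (Site 2)) 1 ⊆ Λ')
    (hz : (0 : Site 2) ∈ Λ') (hP : pairRegion (insert (0 : Site 2) unitSteps) 0 ⊆ Λ')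
    (κp κm u lo : ℝ) (μc : Fin 2 → ℝ) (ν : ℝ)
    (hcap : κp * ω.meanEnergy (hubbardTTPrimeSourcedInteraction 1 t' U μ dWaveFormFactor h) 1 ≤ κp * u)
    (hlo : ∀ σ : InfVolFermionState 2, σ.IsTranslationInvariant → σ.density = ω.density →
      κm * lo ≤ κm * σ.meanEnergy (hubbardTTPrimeFermionInteraction 1 t' U) 1)
    {J : Type*} (Jf : Finset J) (κf hf lf : J → ℝ)
    (hF : ∀ σ : InfVolFermionState 2, σ.IsTranslationInvariant → σ.density = ω.density →
      ∀ j ∈ Jf, κf j * lf j ≤ κf j * σ.meanEnergy (hubbardTTPrimeSourcedInteraction 1 t' U μ dWaveFormFactor (hf j)) 1)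
    {m : Type*} [Fintype m] [DecidableEq m] {Λm : Matrix m m ℂ} (hΛm : Λm.PosSemidef) (O : m → FermionOp Λ')
    {κ' : Type*} (s : Finset κ') (B : κ' → FermionOp Λ)
    {ι : Type*} (tt : Finset ι) (γ : ι → DihedralGroup 4) (wv : ι → Site 2) (fl mt : ι → Fin 2)
    (hsh : ∀ l, d4ShiftSet (γ l) (wv l) Λ ⊆ Λ') (bb : ι → ℂ) (yw : ι → List (Orb (PolySite Λ) × Bool))
    {δ : Type*} (ah : Finset δ) (dc : δ → ℝ) (V : δ → FermionOp Λ')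
    {κ'' : Type*} (w : Finset κ'') (a : κ'' → ℂ) (word : κ'' → List (Orb (PolySite Λ') × Bool))
    {β : Type*} [Fintype β] [DecidableEq β] {G : Matrix β β ℂ} (hG : G.PosSemidef) (Bk : β → FermionOp Λ) {c : ℝ}
    (hcert : (fermionEmbed (PolySite.incl hP) (localPairAt (insert (0 : Site 2) unitSteps) dWaveFormFactor 0) +
          (fermionEmbed (PolySite.incl hP) (localPairAt (insert (0 : Site 2) unitSteps) dWaveFormFactor 0))ᴴ) -
        (c : ℂ) • (1 : FermionOp Λ') -
        ∑ σ : Fin 2, ((μc σ : ℝ) : ℂ) • (nAt 0 hz σ - ((ν : ℝ) : ℂ) • (1 : FermionOp Λ')) -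
        ((κp : ℝ) : ℂ) • (((u : ℝ) : ℂ) • (1 : FermionOp Λ') -
          fermionEmbed (PolySite.incl h0) ((hubbardTTPrimeSourcedInteraction 1 t' U μ dWaveFormFactor h).meanEnergyObs 1)) -
        ((κm : ℝ) : ℂ) • (fermionEmbed (PolySite.incl h0) ((hubbardTTPrimeFermionInteraction 1 t' U).meanEnergyObs 1) -
          ((lo : ℝ) : ℂ) • (1 : FermionOp Λ')) -
        ∑ j ∈ Jf, ((κf j : ℝ) : ℂ) •
          (fermionEmbed (PolySite.incl h0) ((hubbardTTPrimeSourcedInteraction 1 t' U μ dWaveFormFactor (hf j)).meanEnergyObs 1) -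
            ((lf j : ℝ) : ℂ) • (1 : FermionOp Λ')) =
      gramForm Λm O +
        (∑ k ∈ s, (pairSourceWindowHamiltonianTT' dWaveFormFactor Λ' t' U μ h * fermionEmbed (PolySite.incl hΛ) (B k) -
            fermionEmbed (PolySite.incl hΛ) (B k) * pairSourceWindowHamiltonianTT' dWaveFormFactor Λ' t' U μ h) +
          ∑ l ∈ tt, bb l • (gaugePhase (twistFlipExp (γ l) (fl l) (mt l)) (yw l) •
              fermionEmbed (PolySite.incl (hsh l))
                (fermionEmbed (PolySite.d4Emb (γ l) (wv l) Λ) (spinSwapIter (fl l).val (ladderWord (yw l)))) -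
            fermionEmbed (PolySite.incl hΛ) (ladderWord (yw l)))) +
        (∑ m' ∈ ah, ((dc m' : ℝ) : ℂ) • ((V m')ᴴ - V m') + ∑ k ∈ w, a k • ladderWord (word k)) +
        kktForm (pairSourceWindowHamiltonianTT' dWaveFormFactor Λ' t' U μ h) G
          (fun b' => fermionEmbed (PolySite.incl hΛ) (Bk b'))) :
    c - ∑ k ∈ w, ‖a k‖ + (∑ σ : Fin 2, μc σ) * (ω.density / 2 - ν) ≤
      2 * (ω.expect (pairRegion (insert (0 : Site 2) unitSteps) 0) (localPairAt (insert (0 : Site 2) unitSteps) dWaveFormFactor 0)).re := by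
  have hmain := hmin.re_sum_twistedFlipAct_expect_ge_of_sourced_certificate_kkt_fieldRows hΛ h8 h0 hz _ κp κm u lo μc ν hcap hlo
    Jf κf hf lf hF hΛm O s B tt γ wv fl mt hsh bb yw ah dc V w a word hG Bk hcert
  simp_rw [re_expect_fermionEmbed_localPairAt_add_conjTranspose, ← Finset.mul_sum,
    ω.sum_re_expect_localPairAt_dWave_twistedFlipAct] at hmain
  linarith

/-- **RESPONSE FLOOR ON `−∂⁻E(h)` with field rows, STATE-FREE** (grand-canonical «chord ⊕ KKT» / K1a+E shape): pair MIN objective,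
no filling rows, no unsourced floor row, cap row at `h` (`κ⁺ ≥ 0`, certified `E(h) ≤ u`), floor rows at the fields `hⱼ` (`κⱼ ≥ 0`,
certified `ℓⱼ ≤ E(hⱼ)`), ground-state rows ⇒ `c − Σ‖aₖ‖ ≤ −∂⁻E(h)`, `E = dWaveSourceEnergyDensityTT' t' U μ`. With the cap row at `h`
and ONE floor row at `h₁ < h`, `κ⁺ = κ₁ = 1/(h − h₁)`-type multipliers and no other block, this is the cell's Griffiths chord; every further
block can only lift it. [cite: Griffiths1966, §II] [cite: KomaTasaki1994, §1] [cite: WangEtAl2024, §III] -/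
theorem neg_leftDeriv_dWaveSourceEnergyDensityTT'_ge_of_gs_certificate_kkt_fieldRows (t' U μ h : ℝ)
    {Λ Λ' : Finset (Site 2)} (hΛ : Λ ⊆ Λ') (h8 : thicken Λ 1 ⊆ Λ') (h0 : thicken ({0} : Finset (Site 2)) 1 ⊆ Λ')
    (hP : pairRegion (insert (0 : Site 2) unitSteps) 0 ⊆ Λ') {κp u : ℝ} (hκ : 0 ≤ κp)
    (hu : dWaveSourceEnergyDensityTT' t' U μ h ≤ u)
    {J : Type*} (Jf : Finset J) (κf hf lf : J → ℝ) (hκf : ∀ j ∈ Jf, 0 ≤ κf j)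
    (hlf : ∀ j ∈ Jf, lf j ≤ dWaveSourceEnergyDensityTT' t' U μ (hf j))
    {m : Type*} [Fintype m] [DecidableEq m] {Λm : Matrix m m ℂ} (hΛm : Λm.PosSemidef) (O : m → FermionOp Λ')
    {κ' : Type*} (s : Finset κ') (B : κ' → FermionOp Λ)
    {ι : Type*} (tt : Finset ι) (γ : ι → DihedralGroup 4) (wv : ι → Site 2) (fl mt : ι → Fin 2)
    (hsh : ∀ l, d4ShiftSet (γ l) (wv l) Λ ⊆ Λ') (bb : ι → ℂ) (yw : ι → List (Orb (PolySite Λ) × Bool))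
    {δ : Type*} (ah : Finset δ) (dc : δ → ℝ) (V : δ → FermionOp Λ')
    {κ'' : Type*} (w : Finset κ'') (a : κ'' → ℂ) (word : κ'' → List (Orb (PolySite Λ') × Bool))
    {β : Type*} [Fintype β] [DecidableEq β] {G : Matrix β β ℂ} (hG : G.PosSemidef) (Bk : β → FermionOp Λ) {c : ℝ}
    (hcert : (fermionEmbed (PolySite.incl hP) (localPairAt (insert (0 : Site 2) unitSteps) dWaveFormFactor 0) +
          (fermionEmbed (PolySite.incl hP) (localPairAt (insert (0 : Site 2) unitSteps) dWaveFormFactor 0))ᴴ) -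
        (c : ℂ) • (1 : FermionOp Λ') -
        ((κp : ℝ) : ℂ) • (((u : ℝ) : ℂ) • (1 : FermionOp Λ') -
          fermionEmbed (PolySite.incl h0) ((hubbardTTPrimeSourcedInteraction 1 t' U μ dWaveFormFactor h).meanEnergyObs 1)) -
        ∑ j ∈ Jf, ((κf j : ℝ) : ℂ) •
          (fermionEmbed (PolySite.incl h0) ((hubbardTTPrimeSourcedInteraction 1 t' U μ dWaveFormFactor (hf j)).meanEnergyObs 1) -
            ((lf j : ℝ) : ℂ) • (1 : FermionOp Λ')) =
      gramForm Λm O +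
        (∑ k ∈ s, (pairSourceWindowHamiltonianTT' dWaveFormFactor Λ' t' U μ h * fermionEmbed (PolySite.incl hΛ) (B k) -
            fermionEmbed (PolySite.incl hΛ) (B k) * pairSourceWindowHamiltonianTT' dWaveFormFactor Λ' t' U μ h) +
          ∑ l ∈ tt, bb l • (gaugePhase (twistFlipExp (γ l) (fl l) (mt l)) (yw l) •
              fermionEmbed (PolySite.incl (hsh l))
                (fermionEmbed (PolySite.d4Emb (γ l) (wv l) Λ) (spinSwapIter (fl l).val (ladderWord (yw l)))) -
            fermionEmbed (PolySite.incl hΛ) (ladderWord (yw l)))) +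
        (∑ m' ∈ ah, ((dc m' : ℝ) : ℂ) • ((V m')ᴴ - V m') + ∑ k ∈ w, a k • ladderWord (word k)) +
        kktForm (pairSourceWindowHamiltonianTT' dWaveFormFactor Λ' t' U μ h) G
          (fun b' => fermionEmbed (PolySite.incl hΛ) (Bk b'))) :
    c - ∑ k ∈ w, ‖a k‖ ≤ -derivWithin (dWaveSourceEnergyDensityTT' t' U μ) (Iio h) h := by
  obtain ⟨ω₀, hmin, hω₀⟩ := exists_isMeanEnergyMinimiser_two_mul_re_expect_localPairAt_eq_neg_leftDeriv t' U μ h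
  have hz : (0 : Site 2) ∈ Λ' := h0 (subset_thicken _ _ (Finset.mem_singleton_self 0))
  have hcert' : (fermionEmbed (PolySite.incl hP) (localPairAt (insert (0 : Site 2) unitSteps) dWaveFormFactor 0) +
          (fermionEmbed (PolySite.incl hP) (localPairAt (insert (0 : Site 2) unitSteps) dWaveFormFactor 0))ᴴ) -
        (c : ℂ) • (1 : FermionOp Λ') -
        ∑ σ : Fin 2, (((0 : ℝ) : ℝ) : ℂ) • (nAt 0 hz σ - (((0 : ℝ) : ℝ) : ℂ) • (1 : FermionOp Λ')) -
        ((κp : ℝ) : ℂ) • (((u : ℝ) : ℂ) • (1 : FermionOp Λ') -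
          fermionEmbed (PolySite.incl h0) ((hubbardTTPrimeSourcedInteraction 1 t' U μ dWaveFormFactor h).meanEnergyObs 1)) -
        (((0 : ℝ) : ℝ) : ℂ) • (fermionEmbed (PolySite.incl h0) ((hubbardTTPrimeFermionInteraction 1 t' U).meanEnergyObs 1) -
          (((0 : ℝ) : ℝ) : ℂ) • (1 : FermionOp Λ')) -
        ∑ j ∈ Jf, ((κf j : ℝ) : ℂ) •
          (fermionEmbed (PolySite.incl h0) ((hubbardTTPrimeSourcedInteraction 1 t' U μ dWaveFormFactor (hf j)).meanEnergyObs 1) -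
            ((lf j : ℝ) : ℂ) • (1 : FermionOp Λ')) =
      gramForm Λm O +
        (∑ k ∈ s, (pairSourceWindowHamiltonianTT' dWaveFormFactor Λ' t' U μ h * fermionEmbed (PolySite.incl hΛ) (B k) -
            fermionEmbed (PolySite.incl hΛ) (B k) * pairSourceWindowHamiltonianTT' dWaveFormFactor Λ' t' U μ h) +
          ∑ l ∈ tt, bb l • (gaugePhase (twistFlipExp (γ l) (fl l) (mt l)) (yw l) •
              fermionEmbed (PolySite.incl (hsh l))
                (fermionEmbed (PolySite.d4Emb (γ l) (wv l) Λ) (spinSwapIter (fl l).val (ladderWord (yw l)))) -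
            fermionEmbed (PolySite.incl hΛ) (ladderWord (yw l)))) +
        (∑ m' ∈ ah, ((dc m' : ℝ) : ℂ) • ((V m')ᴴ - V m') + ∑ k ∈ w, a k • ladderWord (word k)) +
        kktForm (pairSourceWindowHamiltonianTT' dWaveFormFactor Λ' t' U μ h) G
          (fun b' => fermionEmbed (PolySite.incl hΛ) (Bk b')) := by
    simp only [Complex.ofReal_zero, zero_smul, Finset.sum_const_zero, sub_zero]
    exact hcert
  have hF : ∀ σ : InfVolFermionState 2, σ.IsTranslationInvariant → σ.density = ω₀.density →
      ∀ j ∈ Jf, κf j * lf j ≤ κf j * σ.meanEnergy (hubbardTTPrimeSourcedInteraction 1 t' U μ dWaveFormFactor (hf j)) 1 :=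
    fun σ hσ _ j hj => mul_le_mul_meanEnergy_sourced_of_dWaveSourceEnergyDensityTT'_ge (hκf j hj) (hlf j hj) σ hσ
  have hmain := hmin.le_two_mul_re_expect_localPairAt_of_twistedFlip_certificate_kkt_fieldRows hΛ h8 h0 hz hP κp 0 u 0 (fun _ => 0) 0
    (hmin.mul_meanEnergy_sourced_le_of_le hκ hu) (fun _ _ _ => by simp only [zero_mul, le_refl]) Jf κf hf lf hF hΛm O s B tt γ wv
    fl mt hsh bb yw ah dc V w a word hG Bk hcert'
  rw [hω₀] at hmain
  simpa using hmain

end InfVolFermionState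

end Literature.MathematicalPhysics.QuantumLattice

end
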